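import Mathlib
import Summits.ValiantsHypothesis.ValiantsHypothesis.Theses.AlgebraicKWGames
import Summits.ValiantsHypothesis.ValiantsHypothesis.Theorems.AlgebraicKWGamesBoundedAlternationLowerBoundCount

/-!
# `BoundedAlternationLowerBound` (item stmt-ValiantsHypothesis-10299) — proved

Route `AlgebraicKWGames`, crux rank 4 ("round elimination as calibration"): for all `Δ` and `c` there is
`n ≥ 2` such that no zero-test algebraic protocol of depth `c·(⌊log₂ n⌋+1)²` whose speaker schedule is
oblivious and monotone with at most `Δ` alternations (Alice speaks in even blocks) solves the KW game
of `per_n` over `ℂ`.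

Proof (files `…BoundedAlternationLowerBoundRun/Rank/Potential/Count`): a transcendence-degree adversary
with a LEXICOGRAPHIC RANK POTENTIAL.  On the subspace `{y_e = x_e : e ∈ E}` the generic transcript is a
sequence of polynomials; correctness forces the generic output cell `e ∉ E` and the identification
`y_e ↦ x_e` to kill a nonzero generic message, say first in round `t₀` of block `v₀`.  In the matroid of
algebraically independent subsets of `ℂ[x,y]`, for each block index `v` we track
`rk(x-variables ∪ messages of blocks < v)` and `rk(Bob's E-inputs ∪ messages of blocks < v)`; an
algebra endomorphism never increases such ranks and strictly decreases the rank of a finite set on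
whose generated subalgebra it is not injective, so the kill strictly decreases the speaker's measure
at `v₀` while the measures before `v₀` do not increase.  The base-`(2T+1)` number formed by these digits
therefore drops in every adversary round, so at most `(2T+1)^(Δ+1)` rounds are possible — but each round
only needs two spare cells, a contradiction once `(2T+1)^(Δ+1) + 1 ≤ n²`; we take `n = 2^(2^(2Δ+c+4))`.

Honest framing: a lower bound for a toy communication model with boundedly many alternations (the
calibration crux of a dormant route); the unbounded / history-dependent case `KWPerLowerBound` is
untouched, and nothing here bears on VP versus VNP (which is NOT proved).
-/

-- the summit and the problem share the name `ValiantsHypothesis` (D-0017 single-conjunct layout)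
set_option linter.dupNamespace false

namespace Summit.ValiantsHypothesis.ValiantsHypothesis.Theorems.AlgebraicKWGames

open OneAlt

/-- Arithmetic: the exponent comparison behind the choice `m = 2Δ + c + 4`. -/
theorem exponent_lt (Δ c : ℕ) : (c + 2 * (2 * Δ + c + 4) + 3) * (Δ + 1) < 2 ^ (2 * Δ + c + 4 + 1) := by
  have hA : Δ + 1 ≤ 2 ^ Δ := Nat.lt_two_pow_self
  have hC : c + 1 ≤ 2 ^ c := Nat.lt_two_pow_self
  have hA1 : 1 ≤ 2 ^ Δ := Nat.one_le_two_pow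
  have hC1 : 1 ≤ 2 ^ c := Nat.one_le_two_pow
  have h1 : 3 * 2 ^ c + 4 * 2 ^ Δ + 11 ≤ 18 * 2 ^ Δ * 2 ^ c := by nlinarith
  have h2 : c + 2 * (2 * Δ + c + 4) + 3 ≤ 3 * 2 ^ c + 4 * 2 ^ Δ + 11 := by omega
  have h3 : 2 ^ (2 * Δ + c + 4 + 1) = 32 * (2 ^ Δ * 2 ^ Δ * 2 ^ c) := by
    rw [show 2 * Δ + c + 4 + 1 = Δ + Δ + c + 5 by ring, pow_add, pow_add, pow_add]; ring
  rw [h3]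
  calc (c + 2 * (2 * Δ + c + 4) + 3) * (Δ + 1) ≤ (3 * 2 ^ c + 4 * 2 ^ Δ + 11) * 2 ^ Δ :=
        Nat.mul_le_mul h2 hA
    _ ≤ 18 * 2 ^ Δ * 2 ^ c * 2 ^ Δ := Nat.mul_le_mul_right _ h1
    _ < 32 * (2 ^ Δ * 2 ^ Δ * 2 ^ c) := by nlinarith

/-- The depth budget: with `L = 2^m`, `m = 2Δ+c+4` and `T = c(L+1)²`, `(2T+1)^(Δ+1) + 1 ≤ 2^L · 2^L`. -/
theorem budget (Δ c : ℕ) :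
    (2 * (c * (2 ^ (2 * Δ + c + 4) + 1) ^ 2) + 1) ^ (Δ + 1) + 1 ≤
      2 ^ (2 ^ (2 * Δ + c + 4)) * 2 ^ (2 ^ (2 * Δ + c + 4)) := by
  set m := 2 * Δ + c + 4 with hm
  have hL : 2 ^ m + 1 ≤ 2 ^ (m + 1) := by
    have : 1 ≤ 2 ^ m := Nat.one_le_two_pow
    have h2 : 2 ^ (m + 1) = 2 ^ m * 2 := pow_succ 2 m
    omega
  have hsq : (2 ^ m + 1) ^ 2 ≤ 2 ^ (2 * m + 2) := by
    calc (2 ^ m + 1) ^ 2 ≤ (2 ^ (m + 1)) ^ 2 := Nat.pow_le_pow_left hL 2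
      _ = 2 ^ (2 * m + 2) := by rw [← pow_mul]; ring_nf
  have hT : 2 * (c * (2 ^ m + 1) ^ 2) + 1 ≤ 2 ^ (c + 2 * m + 3) := by
    have h1 : 2 * (c * (2 ^ m + 1) ^ 2) + 1 ≤ (2 * c + 1) * 2 ^ (2 * m + 2) := by
      have : 1 ≤ 2 ^ (2 * m + 2) := Nat.one_le_two_pow
      nlinarith
    calc 2 * (c * (2 ^ m + 1) ^ 2) + 1 ≤ (2 * c + 1) * 2 ^ (2 * m + 2) := h1
      _ ≤ 2 ^ (c + 1) * 2 ^ (2 * m + 2) := by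
          -- `2c + 1 ≤ 2^(c+1)` (also in the tree as `…KST2023.SchemeHyp.two_mul_add_one_le_two_pow`)
          have hc := Nat.lt_two_pow_self (n := c)
          have h2 : 2 ^ (c + 1) = 2 ^ c * 2 := pow_succ 2 c
          exact Nat.mul_le_mul_right _ (by omega)
      _ = 2 ^ (c + 2 * m + 3) := by rw [← pow_add]; ring_nf
  have hpow : (2 * (c * (2 ^ m + 1) ^ 2) + 1) ^ (Δ + 1) ≤ 2 ^ ((c + 2 * m + 3) * (Δ + 1)) := by
    calc (2 * (c * (2 ^ m + 1) ^ 2) + 1) ^ (Δ + 1) ≤ (2 ^ (c + 2 * m + 3)) ^ (Δ + 1) :=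
          Nat.pow_le_pow_left hT _
      _ = 2 ^ ((c + 2 * m + 3) * (Δ + 1)) := by rw [← pow_mul]
  have hexp : (c + 2 * m + 3) * (Δ + 1) < 2 ^ (m + 1) := by
    rw [hm]; exact exponent_lt Δ c
  have hfin : 2 ^ ((c + 2 * m + 3) * (Δ + 1)) + 1 ≤ 2 ^ (2 ^ (m + 1)) := by
    have h1 : 2 ^ ((c + 2 * m + 3) * (Δ + 1)) + 1 ≤ 2 ^ ((c + 2 * m + 3) * (Δ + 1) + 1) := by
      have : 1 ≤ 2 ^ ((c + 2 * m + 3) * (Δ + 1)) := Nat.one_le_two_pow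
      have h2 : 2 ^ ((c + 2 * m + 3) * (Δ + 1) + 1) = 2 ^ ((c + 2 * m + 3) * (Δ + 1)) * 2 := pow_succ 2 _
      omega
    exact h1.trans (Nat.pow_le_pow_right (by norm_num) hexp)
  have hsq2 : 2 ^ (2 ^ (m + 1)) = 2 ^ (2 ^ m) * 2 ^ (2 ^ m) := by
    rw [← pow_add, ← two_mul, ← pow_succ']
  calc (2 * (c * (2 ^ m + 1) ^ 2) + 1) ^ (Δ + 1) + 1 ≤ 2 ^ ((c + 2 * m + 3) * (Δ + 1)) + 1 :=
        Nat.add_le_add_right hpow 1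
    _ ≤ 2 ^ (2 ^ (m + 1)) := hfin
    _ = 2 ^ (2 ^ m) * 2 ^ (2 ^ m) := hsq2

/-- **Item stmt-ValiantsHypothesis-10299 (`BoundedAlternationLowerBound`), proved.**  For all `Δ`,
`c` there is `n ≥ 2` (namely `n = 2^(2^(2Δ+c+4))`) such that no zero-test algebraic protocol of depth
`c·(⌊log₂ n⌋+1)²` with a monotone block schedule of at most `Δ` alternations solves the
Karchmer–Wigderson game of `per_n` over `ℂ`. -/
theorem boundedAlternationLowerBound_proof :
    Summit.ValiantsHypothesis.ValiantsHypothesis.Theses.AlgebraicKWGames.BoundedAlternationLowerBound := by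
  intro Δ c
  refine ⟨2 ^ (2 ^ (2 * Δ + c + 4)), ?_, ?_⟩
  · calc 2 = 2 ^ 1 := by norm_num
      _ ≤ 2 ^ (2 ^ (2 * Δ + c + 4)) := Nat.pow_le_pow_right (by norm_num) Nat.one_le_two_pow
  · rintro ⟨blk, msg, out, hmono, hΔ, hcorr⟩
    have hlog : Nat.log 2 (2 ^ (2 ^ (2 * Δ + c + 4))) = 2 ^ (2 * Δ + c + 4) := Nat.log_pow (by norm_num) _
    let P : AltProtocol (2 ^ (2 ^ (2 * Δ + c + 4)))
        (c * (Nat.log 2 (2 ^ (2 ^ (2 * Δ + c + 4))) + 1) ^ 2) :=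
      { blk := blk, msg := msg, out := out, mono := hmono, correct := hcorr }
    refine P.false_of_le hΔ ?_
    rw [Fintype.card_prod, Fintype.card_fin, hlog]
    exact budget Δ c

end Summit.ValiantsHypothesis.ValiantsHypothesis.Theorems.AlgebraicKWGames
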